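import Literature.Geometry.Lorentzian.KerrRegionIIDiameter
import HarnessLib

/-!
# The `r`-motion of a null geodesic ray confined to Boyer–Lindquist block II: the real-variable core

(family `gr`; namespace `Literature.Geometry.Lorentzian.Kerr`; all results proved; the analytic
half of `KerrRegionIINullIncompleteness.lean`.)

Along a future-directed null geodesic ray `γ|[t₁, ∞)` of sub-extremal Kerr inside block II the
radius `r(t)` is differentiable with `ṙ = ρ < 0`, stays in `(r₋, r₊)`, and Carter's first integrals
give `Σ² ρ² = ℙ(r)² − Δ(r)𝒦` (`ℙ(r) = E(r² + a²) − aL`, `𝒦 ≥ 0`) together with the polar bound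
`(L − a s² E)² ≤ s² 𝒦`, `0 ≤ s² ≤ 1` (O'Neill 1995, Ch. 4, Thm. 4.2.2). This file proves that NO
family of real functions `(r, ρ, Σ, s²)` on a half-line can satisfy these relations
(`Kerr.regionII_ray_contradiction`): the purely real-variable heart of "block II is crossed at
finite affine parameter" (O'Neill 1995, §4.3), by two elementary escape lemmas
(`not_forall_gt_of_deriv_le_neg`, `not_forall_gt_of_sq_deriv_ge`) and a case analysis at
`r⋆ = inf r`. The geometric inputs are supplied in `KerrRegionIINullIncompleteness.lean`.

## References

* B. O'Neill, *The geometry of Kerr black holes*, A K Peters 1995, Ch. 4, §4.2–§4.3. Key `ONeill1995`.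
-/

noncomputable section

open Set Function Real Filter
open scoped Topology

namespace Literature.Geometry.Lorentzian

namespace Kerr

/-! ### Two real-variable escape lemmas -/

/-- **Linear escape**: a function with derivative `≤ −c < 0` on a half-line cannot stay above a
constant there (mean value theorem). [folklore] -/
theorem not_forall_gt_of_deriv_le_neg {f f' : ℝ → ℝ} {T₀ c m : ℝ} (hc : 0 < c)
    (hf : ∀ t, T₀ ≤ t → HasDerivAt f (f' t) t) (hle : ∀ t, T₀ ≤ t → f' t ≤ -c)
    (hlb : ∀ t, T₀ ≤ t → m < f t) : False := by
  have hD : Convex ℝ (Ici T₀) := convex_Ici T₀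
  have hcont : ContinuousOn f (Ici T₀) := fun t ht ↦ (hf t ht).continuousAt.continuousWithinAt
  have hdiff : DifferentiableOn ℝ f (interior (Ici T₀)) := fun t ht ↦ by
    rw [interior_Ici] at ht
    exact (hf t (le_of_lt ht)).differentiableAt.differentiableWithinAt
  have hbound : ∀ t ∈ interior (Ici T₀), deriv f t ≤ -c := fun t ht ↦ by
    rw [interior_Ici] at ht
    rw [(hf t (le_of_lt ht)).deriv]
    exact hle t (le_of_lt ht)
  set t := T₀ + ((f T₀ - m) / c + 1) with ht
  have hT : T₀ ≤ t := by
    have : 0 ≤ (f T₀ - m) / c := div_nonneg (by linarith [hlb T₀ le_rfl]) hc.le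
    linarith
  have h := hD.image_sub_le_mul_sub_of_deriv_le hcont hdiff hbound T₀ self_mem_Ici t hT hT
  have h1 : -c * (t - T₀) = -(f T₀ - m) - c := by rw [ht]; field_simp; ring
  linarith [hlb t hT]

/-- **Square-root escape**: a function with `f' ≤ 0` and `(f')² ≥ c (f − m)`, `c > 0`, on a
half-line cannot stay above `m` there (`√(f − m)` has derivative `≤ −√c/2`). [folklore] -/
theorem not_forall_gt_of_sq_deriv_ge {f f' : ℝ → ℝ} {T₀ c m : ℝ} (hc : 0 < c)
    (hf : ∀ t, T₀ ≤ t → HasDerivAt f (f' t) t) (hle : ∀ t, T₀ ≤ t → f' t ≤ 0)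
    (hsq : ∀ t, T₀ ≤ t → c * (f t - m) ≤ f' t ^ 2) (hlb : ∀ t, T₀ ≤ t → m < f t) : False := by
  set u : ℝ → ℝ := fun t ↦ Real.sqrt (f t - m) with hu
  have hupos : ∀ t, T₀ ≤ t → 0 < u t := fun t ht ↦ Real.sqrt_pos.2 (by linarith [hlb t ht])
  have hud : ∀ t, T₀ ≤ t → HasDerivAt u (f' t / (2 * Real.sqrt (f t - m))) t := fun t ht ↦ by
    have hne : f t - m ≠ 0 := by linarith [hlb t ht]
    have h := (Real.hasDerivAt_sqrt hne).comp t ((hf t ht).sub_const m)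
    refine h.congr_deriv ?_
    ring
  refine not_forall_gt_of_deriv_le_neg (f := u) (f' := fun t ↦ f' t / (2 * Real.sqrt (f t - m)))
    (m := 0) (c := Real.sqrt c / 2) (by positivity) hud (fun t ht ↦ ?_) (fun t ht ↦ hupos t ht)
  -- `f'/(2u) ≤ −√c/2` since `−f' ≥ √c · u`
  have hu0 : 0 < Real.sqrt (f t - m) := hupos t ht
  have hsq' : (Real.sqrt c * Real.sqrt (f t - m)) ^ 2 ≤ (-f' t) ^ 2 := by
    rw [mul_pow, Real.sq_sqrt hc.le, Real.sq_sqrt (by linarith [hlb t ht]), neg_sq]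
    exact hsq t ht
  have hge : Real.sqrt c * Real.sqrt (f t - m) ≤ -f' t :=
    (pow_le_pow_iff_left₀ (by positivity) (by linarith [hle t ht]) two_ne_zero).1 hsq'
  rw [div_le_iff₀ (by positivity)]
  have : -(Real.sqrt c / 2) * (2 * Real.sqrt (f t - m)) = -(Real.sqrt c * Real.sqrt (f t - m)) := by
    ring
  rw [this]
  linarith

/-- `r₋ > 0` for `0 < |a| < M`. [folklore] -/
theorem rMinus_pos_of_ne_zero {M a : ℝ} (h : |a| < M) (ha : a ≠ 0) : 0 < rMinus M a := by
  have hM : 0 < M := IsSubextremal.pos h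
  have ha2 : 0 < a ^ 2 := by positivity
  unfold rMinus
  have hlt : Real.sqrt (M ^ 2 - a ^ 2) < M := by
    rw [Real.sqrt_lt' hM]
    linarith
  linarith

/-! ### The case analysis at `r⋆ = inf r` -/

/-- **No real functions realise the first integrals of a null ray confined to block II.** Let
`|a| ≤ M` (as `a² ≤ M²`), `r₋ < r₊`, `r₋ ≥ 0` and `r₋ > 0` if `a ≠ 0`; let `r, ρ, Σ, s²` be real
functions and `E, L, 𝒦` constants with, for `t ≥ t₁`: `ṙ = ρ < 0`, `r₋ < r < r₊`, `r` non-increasing,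
`𝒦 ≥ 0`, `Σ² ρ² = ℙ(r)² − Δ(r) 𝒦`, `(L − a s² E)² ≤ s² 𝒦`, `r² ≤ Σ ≤ r² + a²`, `Σ > 0`,
`0 ≤ s² ≤ 1`. Then `False` (O'Neill 1995, §4.3: the `r`-motion in block II; see the module
docstring for the case analysis). [cite: ONeill1995, Ch. 4, §4.3] -/
theorem regionII_ray_contradiction {M a E L K t₁ : ℝ} {rf ρ Sg s2 : ℝ → ℝ}
    (ha2 : a ^ 2 ≤ M ^ 2) (hrmp : rMinus M a < rPlus M a) (hrm0 : 0 ≤ rMinus M a)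
    (hrmpos : a ≠ 0 → 0 < rMinus M a)
    (hder : ∀ t, t₁ ≤ t → HasDerivAt rf (ρ t) t) (hρneg : ∀ t, t₁ ≤ t → ρ t < 0)
    (hrm : ∀ t, rMinus M a < rf t) (hrp : ∀ t, t₁ ≤ t → rf t < rPlus M a)
    (hmono : ∀ t t', t₁ ≤ t → t ≤ t' → rf t' ≤ rf t) (hK0 : 0 ≤ K)
    (hrad : ∀ t, t₁ ≤ t → Sg t ^ 2 * ρ t ^ 2 =
      (E * (rf t ^ 2 + a ^ 2) - a * L) ^ 2 - (rf t ^ 2 - 2 * M * rf t + a ^ 2) * K)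
    (hpol : ∀ t, t₁ ≤ t → (L - a * s2 t * E) ^ 2 ≤ s2 t * K)
    (hSub : ∀ t, Sg t ≤ rf t ^ 2 + a ^ 2) (hSge : ∀ t, rf t ^ 2 ≤ Sg t)
    (hSpos : ∀ t, 0 < Sg t) (hs01 : ∀ t, 0 ≤ s2 t ∧ s2 t ≤ 1) : False := by
  have hrp0 : 0 < rPlus M a := hrm0.trans_lt hrmp
  have hA : 0 < rPlus M a ^ 2 + a ^ 2 := add_pos_of_pos_of_nonneg (pow_pos hrp0 2) (sq_nonneg a)
  have hA2 : 0 < (rPlus M a ^ 2 + a ^ 2) ^ 2 := pow_pos hA 2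
  have hx : ∀ t, 0 < rf t := fun t ↦ hrm0.trans_lt (hrm t)
  have hSle : ∀ t, t₁ ≤ t → Sg t ≤ rPlus M a ^ 2 + a ^ 2 := fun t ht ↦ by
    have h2 := pow_le_pow_left₀ (hx t).le (hrp t ht).le 2
    linarith only [hSub t, h2]
  -- the infimum `r⋆` of `r` along the ray
  set B : Set ℝ := rf '' Ici t₁ with hB
  have hBne : B.Nonempty := ⟨rf t₁, t₁, self_mem_Ici, rfl⟩
  have hBbdd : BddBelow B := ⟨rMinus M a, fun y ⟨t, _, hy⟩ ↦ hy ▸ (hrm t).le⟩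
  set rs := sInf B with hrs
  have hrs_le : ∀ t, t₁ ≤ t → rs ≤ rf t := fun t ht ↦ csInf_le hBbdd ⟨t, ht, rfl⟩
  have hrs_ge : rMinus M a ≤ rs := le_csInf hBne fun y ⟨t, _, hy⟩ ↦ hy ▸ (hrm t).le
  have hrs_lt : rs < rPlus M a := (hrs_le t₁ le_rfl).trans_lt (hrp t₁ le_rfl)
  have hnear : ∀ ε, 0 < ε → ∃ T, t₁ ≤ T ∧ ∀ t, T ≤ t → rf t < rs + ε := by
    intro ε hε
    obtain ⟨y, ⟨T, hT, rfl⟩, hy⟩ := exists_lt_of_csInf_lt hBne (lt_add_of_pos_right rs hε)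
    exact ⟨T, hT, fun t ht ↦ (hmono T t hT ht).trans_lt hy⟩
  -- the potential `R(r) = ℙ(r)² − Δ(r) K`
  set P : ℝ → ℝ := fun r ↦ E * (r ^ 2 + a ^ 2) - a * L with hP
  set R : ℝ → ℝ := fun r ↦ P r ^ 2 - (r ^ 2 - 2 * M * r + a ^ 2) * K with hR
  have hRcont : Continuous R := by
    simp only [hR, hP]; fun_prop
  -- CLAIM 1: `R(r⋆) = 0`
  have hR0 : R rs = 0 := by
    by_contra hne
    have hRnn : 0 ≤ R rs := by
      -- `R(r(t)) = Σ²ρ² ≥ 0` and `R ∘ rf → R rs`-free argument: `R ≥ 0` on the image closure point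
      by_contra hneg
      push Not at hneg
      obtain ⟨δ, hδ, hδR⟩ : ∃ δ > 0, ∀ r, |r - rs| < δ → R r < 0 := by
        have := (hRcont.tendsto rs).eventually (gt_mem_nhds hneg)
        obtain ⟨δ, hδ, h⟩ := Metric.eventually_nhds_iff.1 this
        exact ⟨δ, hδ, fun r hr ↦ h (by simpa [Real.dist_eq] using hr)⟩
      obtain ⟨T, hT, hTε⟩ := hnear δ hδ
      have hlt' : R (rf T) < 0 := hδR _ (by
        rw [abs_lt]; constructor <;> linarith only [hrs_le T hT, hTε T le_rfl])
      have hge' : 0 ≤ R (rf T) := by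
        have := hrad T hT
        show 0 ≤ P (rf T) ^ 2 - (rf T ^ 2 - 2 * M * rf T + a ^ 2) * K
        rw [← this]; positivity
      linarith only [hlt', hge']
    have hRpos : 0 < R rs := lt_of_le_of_ne hRnn (Ne.symm hne)
    -- `R ≥ R(rs)/2` near `rs`, hence eventually `ρ ≤ −c`
    obtain ⟨δ, hδ, hδR⟩ : ∃ δ > 0, ∀ r, |r - rs| < δ → R rs / 2 < R r := by
      have := (hRcont.tendsto rs).eventually (lt_mem_nhds (by linarith : R rs / 2 < R rs))
      obtain ⟨δ, hδ, h⟩ := Metric.eventually_nhds_iff.1 this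
      exact ⟨δ, hδ, fun r hr ↦ h (by simpa [Real.dist_eq] using hr)⟩
    obtain ⟨T, hT, hTε⟩ := hnear δ hδ
    set c := Real.sqrt (R rs / 2) / (rPlus M a ^ 2 + a ^ 2) with hc
    have hsq0 : 0 < Real.sqrt (R rs / 2) := Real.sqrt_pos.2 (by linarith only [hRpos])
    have hcpos : 0 < c := div_pos hsq0 hA
    refine not_forall_gt_of_deriv_le_neg (f := rf) (f' := ρ) (T₀ := T) (m := rMinus M a) hcpos
      (fun t ht ↦ hder t (hT.trans ht)) (fun t ht ↦ ?_) (fun t ht ↦ hrm t)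
    have htt : t₁ ≤ t := hT.trans ht
    have hRt : R rs / 2 < Sg t ^ 2 * ρ t ^ 2 := by
      rw [hrad t htt]
      exact hδR _ (by rw [abs_lt]; constructor <;> linarith only [hrs_le t htt, hTε t ht])
    -- `Σ² ρ² > R rs / 2` with `Σ ≤ r₊² + a²` and `ρ < 0` gives `ρ ≤ −c`
    have hρn := hρneg t htt
    have hS := hSle t htt
    have hS0 := hSpos t
    have h1 : Real.sqrt (R rs / 2) < Sg t * (-ρ t) := by
      have h2 : R rs / 2 < (Sg t * (-ρ t)) ^ 2 := by rw [mul_pow, neg_sq]; exact hRt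
      calc Real.sqrt (R rs / 2) < Real.sqrt ((Sg t * (-ρ t)) ^ 2) :=
            Real.sqrt_lt_sqrt (by linarith only [hRpos]) h2
        _ = Sg t * (-ρ t) := Real.sqrt_sq (mul_nonneg hS0.le (by linarith only [hρn]))
    have h2 : Real.sqrt (R rs / 2) < (rPlus M a ^ 2 + a ^ 2) * (-ρ t) :=
      h1.trans_le (mul_le_mul_of_nonneg_right hS (by linarith only [hρn]))
    rw [hc, le_neg, div_le_iff₀ hA]
    linarith only [h2]
  -- consequences: `P(rs) = 0` and `Δ(rs) K = 0`
  have hΔrs : rs ^ 2 - 2 * M * rs + a ^ 2 ≤ 0 := by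
    rw [← sub_rPlus_mul_sub_rMinus ha2 rs]
    exact mul_nonpos_of_nonpos_of_nonneg (by linarith only [hrs_lt]) (by linarith only [hrs_ge])
  have hPrs : P rs = 0 := by
    have h1 : P rs ^ 2 + -(rs ^ 2 - 2 * M * rs + a ^ 2) * K = 0 := by
      have : R rs = P rs ^ 2 - (rs ^ 2 - 2 * M * rs + a ^ 2) * K := rfl
      linarith only [hR0, this]
    have h2 : 0 ≤ -(rs ^ 2 - 2 * M * rs + a ^ 2) * K := mul_nonneg (by linarith only [hΔrs]) hK0
    have h3 : P rs ^ 2 = 0 := by linarith only [h1, h2, sq_nonneg (P rs)]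
    exact pow_eq_zero_iff two_ne_zero |>.1 h3
  have hΔK : (rs ^ 2 - 2 * M * rs + a ^ 2) * K = 0 := by
    have : R rs = P rs ^ 2 - (rs ^ 2 - 2 * M * rs + a ^ 2) * K := rfl
    rw [hPrs] at this
    linarith only [hR0, this]
  -- a trivial ray is impossible: `ρ t₁ ≠ 0`
  have hnontriv : ¬ (E = 0 ∧ L = 0 ∧ K = 0) := by
    rintro ⟨hE0, hL0, hK0'⟩
    have h := hrad t₁ le_rfl
    rw [hE0, hL0, hK0'] at h
    have : Sg t₁ ^ 2 * ρ t₁ ^ 2 = 0 := by rw [h]; ring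
    have hρ0 : ρ t₁ = 0 := by
      rcases mul_eq_zero.1 this with h1 | h1
      · exact absurd (pow_eq_zero_iff two_ne_zero |>.1 h1) (hSpos t₁).ne'
      · exact pow_eq_zero_iff two_ne_zero |>.1 h1
    exact (hρneg t₁ le_rfl).ne hρ0
  -- `K = 0` forces `L = a s² E` along the ray
  have hLE : K = 0 → ∀ t, t₁ ≤ t → L = a * (s2 t) * E := by
    intro hK0' t ht
    have hp := hpol t ht
    rw [hK0', mul_zero] at hp
    have := le_antisymm hp (sq_nonneg _)
    exact sub_eq_zero.1 (pow_eq_zero_iff two_ne_zero |>.1 this)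
  rcases eq_or_lt_of_le hrs_ge with hrs_eq | hrs_gt
  · -- CASE `r⋆ = r₋`
    rcases eq_or_lt_of_le hK0 with hK0' | hKpos
    · -- `K = 0`: `L = a s² E`, `P(r₋) = 0`
      have hK0'' : K = 0 := hK0'.symm
      have hLt₁ := hLE hK0'' t₁ le_rfl
      have hPm : E * (rMinus M a ^ 2 + a ^ 2) - a * L = 0 := by rw [hrs_eq]; exact hPrs
      rcases eq_or_ne a 0 with ha0 | ha0
      · -- `a = 0`: `ρ = −|E|` constant
        have hL0 : L = 0 := hLt₁.trans (mul_eq_zero_of_left (mul_eq_zero_of_left ha0 _) _)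
        have hE0 : E ≠ 0 := fun hE0 ↦ hnontriv ⟨hE0, hL0, hK0''⟩
        -- `Σ² ρ² = E² r⁴` with `r⁴ ≤ Σ² ≤ (r²+0)²`
        refine not_forall_gt_of_deriv_le_neg (f := rf) (f' := ρ) (T₀ := t₁) (m := rMinus M a)
          (abs_pos.2 hE0) hder (fun t ht ↦ ?_) (fun t _ ↦ hrm t)
        have h1 := hrad t ht
        rw [hK0'', hL0, ha0] at h1
        simp only [mul_zero, sub_zero, zero_pow two_ne_zero, add_zero] at h1
        have hS1 : Sg t = rf t ^ 2 := by
          have hb : Sg t ≤ rf t ^ 2 + a ^ 2 := hSub t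
          have ha2' : a ^ 2 = 0 := by rw [ha0]; ring
          exact le_antisymm (by linarith only [hb, ha2']) (hSge t)
        rw [hS1] at h1
        have hr0 : 0 < rf t := hx t
        have h2 : ρ t ^ 2 = E ^ 2 := by
          have : (rf t ^ 2) ^ 2 ≠ 0 := by positivity
          have h3 : (rf t ^ 2) ^ 2 * ρ t ^ 2 = (rf t ^ 2) ^ 2 * E ^ 2 := by rw [h1]; ring
          exact mul_left_cancel₀ this h3
        have h4 : ρ t = -|E| := by
          have h5 : |ρ t| = |E| := (sq_eq_sq_iff_abs_eq_abs (ρ t) E).1 h2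
          rw [abs_of_neg (hρneg t ht)] at h5
          linarith only [h5]
        rw [h4]
      · -- `a ≠ 0`: `a² s² = r₋² + a²` is impossible unless `E = 0`, and then `L = 0`
        have hE0 : E = 0 := by
          by_contra hE0
          have h1 : a * L = E * (rMinus M a ^ 2 + a ^ 2) := by linarith only [hPm]
          rw [hLt₁] at h1
          have h2 : a ^ 2 * (s2 t₁) = rMinus M a ^ 2 + a ^ 2 := by
            have h3 : (a ^ 2 * (s2 t₁) - (rMinus M a ^ 2 + a ^ 2)) * E = 0 := by
              linear_combination h1
            exact sub_eq_zero.1 ((mul_eq_zero.1 h3).resolve_right hE0)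
          have hrm0' : 0 < rMinus M a := hrmpos ha0
          have hs := (hs01 t₁).2
          have h4 : a ^ 2 * (s2 t₁) ≤ a ^ 2 * 1 :=
            mul_le_mul_of_nonneg_left hs (sq_nonneg a)
          have h5 : 0 < rMinus M a ^ 2 := pow_pos hrm0' 2
          linarith only [h2, h4, h5]
        have hL0 : L = 0 := hLt₁.trans (mul_eq_zero_of_right _ hE0)
        exact hnontriv ⟨hE0, hL0, hK0''⟩
    · -- `K > 0`: `Σ² ρ² ≥ (r₊ − r(t₁)) K (r − r₋)`
      set c := (rPlus M a - rf t₁) * K / (rPlus M a ^ 2 + a ^ 2) ^ 2 with hc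
      have hcpos : 0 < c :=
        div_pos (mul_pos (sub_pos.2 (hrp t₁ le_rfl)) hKpos) hA2
      refine not_forall_gt_of_sq_deriv_ge (f := rf) (f' := ρ) (T₀ := t₁) (m := rMinus M a) hcpos
        hder (fun t ht ↦ (hρneg t ht).le) (fun t ht ↦ ?_) (fun t _ ↦ hrm t)
      have h1 := hrad t ht
      have hΔfac : rf t ^ 2 - 2 * M * rf t + a ^ 2 = (rf t - rPlus M a) * (rf t - rMinus M a) :=
        (sub_rPlus_mul_sub_rMinus ha2 (rf t)).symm
      have hrt := hrp t ht
      have hrt₁ := hmono t₁ t le_rfl ht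
      have hrm' := hrm t
      have hS := hSle t ht
      have hS0 := hSpos t
      -- `Σ² ρ² ≥ −Δ K ≥ (r₊ − r(t₁)) K (r − r₋)`
      have h2 : (rPlus M a - rf t₁) * K * (rf t - rMinus M a) ≤ Sg t ^ 2 * ρ t ^ 2 := by
        rw [h1, hΔfac]
        have hA : (rPlus M a - rf t₁) * K * (rf t - rMinus M a) ≤
            (rPlus M a - rf t) * K * (rf t - rMinus M a) :=
          mul_le_mul_of_nonneg_right (mul_le_mul_of_nonneg_right (by linarith only [hrt₁]) hKpos.le)
            (by linarith only [hrm'])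
        have hB : (rPlus M a - rf t) * K * (rf t - rMinus M a) =
            -((rf t - rPlus M a) * (rf t - rMinus M a) * K) := by ring
        linarith only [hA, hB, sq_nonneg (E * (rf t ^ 2 + a ^ 2) - a * L)]
      have h3 : Sg t ^ 2 * ρ t ^ 2 ≤ (rPlus M a ^ 2 + a ^ 2) ^ 2 * ρ t ^ 2 := by
        have : Sg t ^ 2 ≤ (rPlus M a ^ 2 + a ^ 2) ^ 2 := pow_le_pow_left₀ hS0.le hS 2
        exact mul_le_mul_of_nonneg_right this (sq_nonneg _)
      rw [hc, div_mul_eq_mul_div, div_le_iff₀ hA2]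
      linarith only [h2, h3]
  · -- CASE `r⋆ > r₋`: `Δ(r⋆) < 0`, so `K = 0`, and `P(r⋆) = 0` forces a trivial ray
    have hΔrs' : rs ^ 2 - 2 * M * rs + a ^ 2 < 0 := by
      rw [← sub_rPlus_mul_sub_rMinus ha2 rs]
      exact mul_neg_of_neg_of_pos (by linarith only [hrs_lt]) (by linarith only [hrs_gt])
    have hK0' : K = 0 := by
      rcases mul_eq_zero.1 hΔK with h1 | h1
      · exact absurd h1 hΔrs'.ne
      · exact h1
    have hE0 : E = 0 := by
      by_contra hE0
      have hrs0 : 0 < rs := hrm0.trans_lt hrs_gt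
      -- close to `rs`: `|P(r)| = |E| (r² − rs²) < |E| rs² ≤ |E| r² ≤ |P(r)|`
      obtain ⟨T, hT, hTε⟩ := hnear (rs / 3) (by linarith only [hrs0])
      have hLT := hLE hK0' T hT
      have hrT := hrs_le T hT
      have hεT := hTε T le_rfl
      have hs := hs01 T
      -- `P(r_T) = E (r_T² + a² (1 − s²))` and `P(r_T) = E (r_T² − rs²)` (as `P rs = 0`)
      have hP1 : P (rf T) = E * (rf T ^ 2 + a ^ 2 * (1 - s2 T)) := by
        show E * (rf T ^ 2 + a ^ 2) - a * L = _
        rw [hLT]; ring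
      have hP2 : P (rf T) = E * (rf T ^ 2 - rs ^ 2) := by
        have : P rs = E * (rs ^ 2 + a ^ 2) - a * L := rfl
        show E * (rf T ^ 2 + a ^ 2) - a * L = _
        linear_combination hPrs
      have hrs2 : rs ^ 2 ≤ rf T ^ 2 := pow_le_pow_left₀ hrs0.le hrT 2
      have hs2' : 0 ≤ a ^ 2 * (1 - s2 T) := mul_nonneg (sq_nonneg a) (sub_nonneg.2 (hs01 T).2)
      have hX0 : 0 ≤ rf T ^ 2 + a ^ 2 * (1 - s2 T) := add_nonneg (sq_nonneg _) hs2'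
      have hbig : |E| * rs ^ 2 ≤ |P (rf T)| := by
        rw [hP1, abs_mul, abs_of_nonneg hX0]
        refine mul_le_mul_of_nonneg_left ?_ (abs_nonneg E)
        linarith only [hrs2, hs2']
      have hq0 : 0 ≤ rf T ^ 2 - rs ^ 2 := by linarith only [hrs2]
      have hu : rf T < 4 / 3 * rs := by linarith only [hεT]
      have hu2 : rf T ^ 2 < (4 / 3 * rs) ^ 2 := pow_lt_pow_left₀ hu (hx T).le two_ne_zero
      have hq : rf T ^ 2 - rs ^ 2 < rs ^ 2 := by nlinarith only [hu2, hrs0]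
      have hsmall : |P (rf T)| < |E| * rs ^ 2 := by
        rw [hP2, abs_mul, abs_of_nonneg hq0]
        exact mul_lt_mul_of_pos_left hq (abs_pos.2 hE0)
      linarith only [hbig, hsmall]
    have hL0 : L = 0 := (hLE hK0' t₁ le_rfl).trans (mul_eq_zero_of_right _ hE0)
    exact hnontriv ⟨hE0, hL0, hK0'⟩


end Kerr

end Literature.Geometry.Lorentzian

end
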